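import Literature.NumberTheory.Automorphic.QuadraticBaseChangeFrobCompatibleOfFactsProofs
import Literature.NumberTheory.Automorphic.CarayolUnramifiedOfLocalGlobalProofs
import Literature.NumberTheory.Automorphic.GL2UnramifiedLFactorDivisibility
import Literature.NumberTheory.Automorphic.LocalComponentBJSatakeProofs
import Literature.NumberTheory.Automorphic.AdicCompletionResidueCard
import Literature.NumberTheory.GaloisRepresentations.DecompositionGroupOfCompletion
import Literature.NumberTheory.GaloisRepresentations.GaloisRepFrobeniusProofs
import Literature.NumberTheory.EllipticCurves.EisensteinNewformLevelRaisingInertiaLocalGlobalProofs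
import HarnessLib

/-!
# Carayol's compatibility AT every `w ∤ ℓ` from local–global compatibility; Carayol's theorem
# and Langlands' quadratic base change compatibility from four named facts

Topic `Literature/NumberTheory/Automorphic`; proof file (theorems only: no definition, no named
fact, no instance).  Companion of `CarayolUnramifiedOfLocalGlobalProofs` (clause (ii)).

The named fact `Carayol1986_unramifiedCompatibility` (`HilbertModularGaloisRepUnramified`;
Carayol 1986, Thm. (A); Taylor 1989) has two clauses at a finite place `w ∤ ℓ` of a totally real
`K`, for `π` regular algebraic cuspidal on `GL₂(𝔸_K)` and `r : Γ_K → GL₂(ℚ̄_ℓ)` irreducible and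
a.e. compatible with `π`: (i) `IsGaloisCompatibleAt π ι r w` — for every Satake parameter `α` of
`π` at `w`, `r` is unramified at `w` and `charpoly r(Frob_w) = ∏ (X - ι⁻¹((q^{1/2} αⱼ)⁻¹))` — and
(ii) `r` unramified at `w` ⇒ `π` unramified at `w`.  Clause (ii) was derived from the tree's
local–global compatibility fact `galoisRep_GL2_totallyReal_localGlobal` (`HilbertModularLocalGlobal`:
"`rec_w(π_w) = WD(r|_w)^{F-ss}`") in `CarayolUnramifiedOfLocalGlobalProofs`.  Here clause (i) is
derived from the same fact (`Carayol1986_unramifiedCompatibility.compatible_of_localGlobal`), so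
that

* `Carayol1986_unramifiedCompatibility_of_localGlobal (hLG) : Carayol1986_unramifiedCompatibility`,
* `Langlands1980_quadraticBaseChange_frobCompatible_of_localGlobal_of_baseChange
   (hLG) (hArch) (hBCc) (hACu) : Langlands1980_quadraticBaseChange_frobCompatible`

— Langlands' Frobenius compatibility of quadratic base change (`QuadraticBaseChangeFrobCompatible`)
from four EXISTING named facts: `galoisRep_GL2_totallyReal_localGlobal`,
`ArthurClozel1989_strongLifting_archimedean`, `baseChange_cyclic_cuspidal`,
`ArthurClozel1989_strongLifting_unramified` (neither Carayol's theorem nor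
`exists_galoisRep_of_regularAlgebraic` is used any more).

## The argument for clause (i)

The point missing so far was the UNRAMIFIED NORMALISATION of the abstract local Langlands datum
`llc w` of the fact: for a spherical `π_w` with Satake parameter `β`, every Frobenius-semisimple
representative of `rec_w(π_w)` is unramified with `N = 0` and `det(1 - TΦ) = ∏ (1 - βⱼ T)`.  It is
not a clause of `LocalLanglandsDatum`, but it FOLLOWS from clause (iii-L) (`lFactor_pairs`,
preservation of the JPSS `L`-factors of pairs) and the now proved local theorem of
`GL2UnramifiedLFactorDivisibility` (the spherical zeta integral: `∏ (1 - βⱼ T)` divides every JPSS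
`L`-polynomial of `(π_w, 1)`, with equality in degree `≤ 2`):

1. `Matrix.charpoly_add_eq_of_isNilpotent_of_commute` — a commuting nilpotent perturbation does not
   change the characteristic polynomial (over `K(X)`, `det(1 + nilpotent) = 1`).
2. Weil–Deligne algebra (Tate 1979, (4.1.6)): `deg det(1 - TΦ | (ker N)^I) ≤ dim (ker N)^I`
   (`natDegree_eulerFactor_le`), full degree forces `(ker N)^I = V`
   (`inertiaInvariantsKerN_eq_top_of_natDegree_eulerFactor_eq`), and then the Euler factor is
   `det(1 - TΦ | V)` (`eulerFactor_eq_reverse_charpoly_of_eq_top`); for `A ⊗ 1`: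
   `N_eq_zero_and_inertia_trivial_of_tprod_eq_top`, `charpoly_tprod_ρ_eq`.
3. `WeilDeligneRep.unramified_of_hasFrobSemisimpleClass_recGL_of_isSatakeParameter` — the local
   deduction: (iii-L) gives `HasRSLFactor π_w 1 ψ ν P₀` with `P₀` the Euler factor of
   `rec(π_w) ⊗ rec(1)`; `deg P₀ ≤ 2`, so `P₀ = ∏ (1 - βⱼ T)` of degree `2 = dim`; hence `rec(π_w)`
   has `N = 0`, trivial inertia and `det(1 - TΦ) = ∏ (1 - βⱼ T)`, and so does every `rℂ` whose
   Frobenius-semisimplification lies in that class (equivalence; same `N`, same inertia,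
   Frobenius differing by a commuting nilpotent — Deligne 1973, §8.6).
4. `FramedGaloisRep.isUnramifiedAt_and_hasFrobCharpolyAt_of_weilDeligne` — back to `r`: the recipe
   with `N = 0` returns `r|_{W_{K_w}}` (Tate 1979, (4.2.1)), the transport is entrywise `ι`,
   `I_{𝔓₀} = res(I_{K_w})` and `res(Φ⁻¹)` is an arithmetic Frobenius at the prime `𝔓₀ ∣ w` of the
   chosen embedding (`DecompositionGroupOfCompletion`; Neukirch, Ch. II (9.6)),
   `charpoly(M⁻¹) = det(M)⁻¹ det(1 - T M)` (Mathlib `Matrix.charpoly_inv`), and Frobenii at `w`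
   are conjugate modulo inertia (`IsUnramifiedAt.hasFrobCharpolyAt_charpoly`).
5. `Carayol1986_unramifiedCompatibility.compatible_of_localGlobal` — clause (i): inverse half twist
   `π₁ = π ⊗ |det|^{-1/2}`, the fact at `w`, genericity of `π₁,w`
   (`exists_isGeneric_of_hasLocalComponentAt`), its Satake parameter
   (`isSatakeParameter_of_hasLocalComponentAt`, `LocalComponentBJSatakeProofs`), 3., 4., and
   `arithFrobPolyOfSatake ι q 1 (q^{1/2} α) = arithFrobPolyOfSatake ι q 2 α`.

## References

* H. Carayol, Ann. Sci. ÉNS 19 (1986) 409–468, Thm. (A). [CarayolASENS1986]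
* R. Taylor, Invent. Math. 98 (1989) 265–280, Thms. 1–2. [TaylorInventMath1989]
* C. Skinner, Doc. Math. 14 (2009) 241–258, (1) p. 242. [Skinner2009]
* J. Tate, *Number theoretic background*, Corvallis 1979, (4.1.6), (4.2.1). [TateCorvallis1979]
* P. Deligne, *Les constantes des équations fonctionnelles des fonctions L*, Antwerp II (1973),
  §8.4–8.6. [DeligneAntwerpII1973]
* M. Harris, R. Taylor, Ann. of Math. Stud. 151 (2001), Thm. A (ii), (v). [HarrisTaylorAMS2001]
* H. Jacquet, R. P. Langlands, LNM 114 (1970), Prop. 3.5. [JacquetLanglands1970]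
* J. Neukirch, *Algebraic Number Theory*, Ch. II §9, Prop. (9.6). [NeukirchANT1999]
* R. P. Langlands, *Base change for GL(2)* (1980), §2 (A), (F). [LanglandsBaseChange1980]
-/

noncomputable section

open scoped MatrixGroups Matrix NumberField TensorProduct
open NumberField IsDedekindDomain Field Filter Polynomial MeasureTheory Finset ValuativeRel

namespace Literature.NumberTheory.Automorphic

open Literature.NumberTheory.GaloisRepresentations
open Literature.NumberTheory.GaloisRepresentations.IsNonarchimedeanLocalField
open Literature.RingTheory.SymmetricFunctions.SymmPoly
open Literature.NumberTheory.EllipticCurves.Hida2000Thm326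
  (det_one_add_eq_one_of_isNilpotent exists_haar_measure_quotient_fin_one)

/-! ### Part 1: a commuting nilpotent perturbation does not change the characteristic polynomial -/

section Nilpotent

variable {K : Type*} [Field K] {ι : Type*} [Fintype ι] [DecidableEq ι]

/-- `charmatrix (A + B) = charmatrix A - C(B)`. [folklore] -/
theorem Matrix.charmatrix_add (A B : Matrix ι ι K) :
    (A + B).charmatrix = A.charmatrix - B.map C := by
  ext i j
  rw [Matrix.charmatrix_apply, Matrix.sub_apply, Matrix.charmatrix_apply, Matrix.map_apply,
    Matrix.add_apply, map_add]
  ring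

/-- **`charpoly (A + B) = charpoly A` for `B` nilpotent commuting with `A`** (over a field): in
`K(X)` the matrix `X - A` is invertible and `det(X - A - B) = det(X - A) det(1 - (X - A)⁻¹ B)`
with `(X - A)⁻¹ B` nilpotent, whose determinant factor is `1`.  (The semisimple part of an
endomorphism has the same characteristic polynomial; Bourbaki, *Algèbre* VII §5.) [folklore] -/
theorem Matrix.charpoly_add_eq_of_isNilpotent_of_commute {A B : Matrix ι ι K} (hB : IsNilpotent B)
    (hAB : Commute A B) : (A + B).charpoly = A.charpoly := by
  let L := FractionRing K[X]
  let f : K[X] →+* L := algebraMap K[X] L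
  have hf : Function.Injective f := IsFractionRing.injective K[X] L
  apply hf
  rw [Matrix.charpoly, Matrix.charpoly, RingHom.map_det, RingHom.map_det, Matrix.charmatrix_add,
    map_sub]
  set P : Matrix ι ι L := f.mapMatrix A.charmatrix with hP_def
  set Q : Matrix ι ι L := f.mapMatrix (B.map C) with hQ_def
  -- `P` is invertible
  have hPdet : IsUnit P.det := by
    rw [hP_def, ← RingHom.map_det, isUnit_iff_ne_zero]
    exact (map_ne_zero_iff f hf).2 (Matrix.charpoly_monic A).ne_zero
  have hP : IsUnit P := (Matrix.isUnit_iff_isUnit_det P).2 hPdet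
  -- `Q` is nilpotent and commutes with `P`
  have hQ : IsNilpotent Q := by
    have h := hB.map ((f.comp (C : K →+* K[X])).mapMatrix)
    rw [RingHom.mapMatrix_apply, RingHom.coe_comp, ← Matrix.map_map] at h
    exact h
  have hPQ : Commute P Q := by
    have h1 : Commute A.charmatrix (B.map C) := by
      rw [Matrix.charmatrix]
      refine Commute.sub_left (Matrix.scalar_commute _ (fun r' => Commute.all _ _) _) ?_
      exact hAB.map (C : K →+* K[X]).mapMatrix
    exact h1.map f.mapMatrix
  -- `P - Q = P (1 - P⁻¹ Q)` and `det (1 - P⁻¹ Q) = 1`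
  obtain ⟨u, hu⟩ := hP
  have hPQ' : Commute P⁻¹ Q := by
    have h := Commute.units_inv_left (hu ▸ hPQ : Commute (u : Matrix ι ι L) Q)
    rwa [Matrix.coe_units_inv, hu] at h
  have hnil : IsNilpotent (-(P⁻¹ * Q)) := (hPQ'.isNilpotent_mul_left hQ).neg
  have hfac : P - Q = P * (1 + -(P⁻¹ * Q)) := by
    rw [mul_add, mul_one, mul_neg, ← mul_assoc, Matrix.mul_nonsing_inv _ hPdet, one_mul,
      sub_eq_add_neg]
  rw [hfac, Matrix.det_mul, det_one_add_eq_one_of_isNilpotent hnil, mul_one]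

/-- The same for endomorphisms of `Fin m → K`. [folklore] -/
theorem LinearMap.charpoly_add_eq_of_isNilpotent_of_commute {m : ℕ} {f n : Module.End K (Fin m → K)}
    (hn : IsNilpotent n) (hc : Commute n f) : (f + n).charpoly = f.charpoly := by
  have h1 : ∀ g : Module.End K (Fin m → K), g.charpoly = (LinearMap.toMatrix' g).charpoly := fun g => by
    rw [← LinearMap.toMatrix_eq_toMatrix', LinearMap.charpoly_toMatrix]
  rw [h1, h1, map_add]
  exact Matrix.charpoly_add_eq_of_isNilpotent_of_commute (hn.map LinearMap.toMatrixAlgEquiv')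
    (hc.map LinearMap.toMatrixAlgEquiv').symm

end Nilpotent

/-! ### Part 2: Weil–Deligne linear algebra around the Euler factor -/

section WD

variable {F : Type} [Field F] [ValuativeRel F] [TopologicalSpace F] [IsNonarchimedeanLocalField F]
variable {C : Type*} [Field C] [CharZero C] {V : Type*} [AddCommGroup V] [Module C V]
  [FiniteDimensional C V]

/-- `deg det(1 - TΦ | (ker N)^I) ≤ dim (ker N)^I`. Tate, Corvallis 1979, (4.1.6). [cite: TateCorvallis1979, (4.1.6)] -/
theorem natDegree_eulerFactor_le (r : WeilDeligneRep F C V) (hn : absInertia_normal F)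
    (hex : exists_isFrobPow (F := F)) :
    (r.eulerFactor hn hex).natDegree ≤ Module.finrank C r.inertiaInvariantsKerN := by
  classical
  unfold WeilDeligneRep.eulerFactor
  rw [← Matrix.reverse_charpoly]
  refine (Polynomial.reverse_natDegree_le _).trans ?_
  rw [Matrix.charpoly_natDegree_eq_dim, Fintype.card_fin]

/-- If the Euler factor has the full degree `dim V`, then `(ker N)^I = V`. [cite: TateCorvallis1979, (4.1.6)] -/
theorem inertiaInvariantsKerN_eq_top_of_natDegree_eulerFactor_eq (r : WeilDeligneRep F C V)
    (hn : absInertia_normal F) (hex : exists_isFrobPow (F := F))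
    (h : (r.eulerFactor hn hex).natDegree = Module.finrank C V) : r.inertiaInvariantsKerN = ⊤ :=
  Submodule.eq_top_of_finrank_eq (le_antisymm (Submodule.finrank_le _)
    (h ▸ natDegree_eulerFactor_le r hn hex))

/-- With `(ker N)^I = V` the Euler factor is the reversed characteristic polynomial of `ρ(Φ)` on all
of `V`. [cite: TateCorvallis1979, (4.1.6)] -/
theorem eulerFactor_eq_reverse_charpoly_of_eq_top (r : WeilDeligneRep F C V) (hn : absInertia_normal F)
    (hex : exists_isFrobPow (F := F)) (htop : r.inertiaInvariantsKerN = ⊤) :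
    r.eulerFactor hn hex = (r.ρ (WeilDeligneRep.geomFrob F hex)).charpoly.reverse := by
  classical
  unfold WeilDeligneRep.eulerFactor
  rw [← Matrix.reverse_charpoly, LinearMap.charpoly_toMatrix]
  congr 1
  have hconj : (LinearEquiv.ofTop _ htop).conj
      (r.restrictInertiaInvariantsKerN hn (WeilDeligneRep.geomFrob F hex)) =
      r.ρ (WeilDeligneRep.geomFrob F hex) := by
    refine LinearMap.ext fun v => ?_
    simp only [LinearEquiv.conj_apply, LinearMap.comp_apply, LinearEquiv.coe_coe,
      LinearEquiv.ofTop_apply, WeilDeligneRep.coe_restrictInertiaInvariantsKerN_apply,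
      LinearEquiv.ofTop_symm_apply]
  rw [← hconj, LinearEquiv.charpoly_conj]

omit [CharZero C] [FiniteDimensional C V] in
/-- `x ⊗ 1 = 0` in `V ⊗ C¹` forces `x = 0`. [folklore] -/
theorem eq_zero_of_tmul_const_one_eq_zero (x : V)
    (h : x ⊗ₜ[C] (fun _ : Fin 1 => (1 : C)) = 0) : x = 0 := by
  set θ : V ⊗[C] (Fin 1 → C) →ₗ[C] V :=
    (TensorProduct.rid C V).toLinearMap ∘ₗ TensorProduct.map LinearMap.id (LinearMap.proj 0) with hθ
  have hx : θ (x ⊗ₜ[C] (fun _ : Fin 1 => (1 : C))) = x := by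
    simp [hθ, TensorProduct.map_tmul]
  rw [← hx, h, map_zero]

omit [FiniteDimensional C V] in
/-- **`(ker N)^I` of `A ⊗ 1` is everything only if `A` has `N = 0` and trivial inertia action**
(`1` the trivial one-dimensional Weil–Deligne representation on `C¹`). Deligne, Antwerp II (1973),
(8.1.2). [folklore] -/
theorem N_eq_zero_and_inertia_trivial_of_tprod_eq_top (A : WeilDeligneRep F C V)
    (B : WeilDeligneRep F C (Fin 1 → C)) (hBN : B.N = 0) (hBρ : ∀ u x, B.ρ u x = x)
    (htop : (A.tprod B).inertiaInvariantsKerN = ⊤) :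
    A.N = 0 ∧ ∀ u ∈ WeilGroup.inertia F, A.ρ u = 1 := by
  have key : ∀ a : V, a ⊗ₜ[C] (fun _ : Fin 1 => (1 : C)) ∈ (A.tprod B).inertiaInvariantsKerN :=
    fun a => by rw [htop]; exact Submodule.mem_top
  refine ⟨?_, fun u hu => ?_⟩
  · refine LinearMap.ext fun a => ?_
    have h1 := (((A.tprod B).mem_inertiaInvariantsKerN_iff _).1 (key a)).1
    rw [WeilDeligneRep.tprod_N, LinearMap.add_apply, TensorProduct.map_tmul, TensorProduct.map_tmul,
      hBN, LinearMap.zero_apply, TensorProduct.tmul_zero, add_zero, Module.End.one_apply] at h1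
    rw [LinearMap.zero_apply]
    exact eq_zero_of_tmul_const_one_eq_zero _ h1
  · refine LinearMap.ext fun a => ?_
    have h := (((A.tprod B).mem_inertiaInvariantsKerN_iff _).1 (key a)).2 u hu
    rw [WeilDeligneRep.tprod_ρ_apply, TensorProduct.map_tmul, hBρ] at h
    have h2 : (A.ρ u a - a) ⊗ₜ[C] (fun _ : Fin 1 => (1 : C)) = 0 := by
      rw [TensorProduct.sub_tmul, h, sub_self]
    rw [Module.End.one_apply]
    exact sub_eq_zero.1 (eq_zero_of_tmul_const_one_eq_zero _ h2)

/-- **`charpoly (A ⊗ 1)(w) = charpoly A(w)`** (`V ⊗ C¹ ≅ V`). [folklore] -/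
theorem charpoly_tprod_ρ_eq (A : WeilDeligneRep F C V) (B : WeilDeligneRep F C (Fin 1 → C))
    (hBρ : ∀ u x, B.ρ u x = x) (w : WeilGroup F) :
    ((A.tprod B).ρ w).charpoly = (A.ρ w).charpoly := by
  set ε : V ⊗[C] (Fin 1 → C) ≃ₗ[C] V :=
    (TensorProduct.congr (LinearEquiv.refl C V) (LinearEquiv.funUnique (Fin 1) C C)).trans
      (TensorProduct.rid C V) with hε
  have hB1 : B.ρ w = LinearMap.id := LinearMap.ext fun x => hBρ w x
  have hconj : ε.conj ((A.tprod B).ρ w) = A.ρ w := by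
    refine LinearMap.ext fun v => ?_
    simp only [LinearEquiv.conj_apply, LinearMap.comp_apply, LinearEquiv.coe_coe,
      WeilDeligneRep.tprod_ρ_apply, hB1]
    simp [hε, TensorProduct.map_tmul]
  rw [← hconj, LinearEquiv.charpoly_conj]

end WD

/-! ### Part 3: the local deduction at a spherical `π_v` -/

section Local

variable {F : Type} [Field F] [ValuativeRel F] [TopologicalSpace F] [IsNonarchimedeanLocalField F]

/-- Endomorphisms of `Fin m → C`: `charpoly` through `toMatrix'`. [folklore] -/
theorem charpoly_eq_charpoly_toMatrix' {C : Type*} [Field C] {m : ℕ} (g : Module.End C (Fin m → C)) :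
    g.charpoly = (LinearMap.toMatrix' g).charpoly := by
  rw [← LinearMap.toMatrix_eq_toMatrix', LinearMap.charpoly_toMatrix]

/-- **The local deduction.**  Let `d` be a local Langlands datum of `F`, `π_v` an irreducible
smooth `ψ`-generic representation of `GL₂(F)` with Satake parameter `{x₀, x₁}`
(`IsSatakeParameter`), and `rℂ` a Weil–Deligne representation on `ℂ²` whose
Frobenius-semisimplification has class `d.recGL 2 ⟦π_v⟧`.  Then `rℂ.N = 0`, `rℂ.ρ` is unramified,
and `det(1 - T rℂ.ρ(Φ)) = 1 - e₁(x) T + e₂(x) T² = ∏ (1 - xᵢ T)` for the geometric Frobenius `Φ`: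
clause (iii-L) of the datum (`lFactor_pairs`) gives the JPSS `L`-polynomial
`P₀ = det(1 - TΦ | (ker N)^I)` of `rec(π_v) ⊗ rec(1)` for the pair `(π_v, 1)`, which by
`prod_one_sub_C_mul_X_eq_of_hasRSLFactor_of_natDegree_le_two` (the spherical zeta integral, FILE
`GL2UnramifiedLFactorDivisibility`) equals `∏ (1 - xᵢ T)` of degree `2 = dim`, so `(ker N)^I` is
everything (`N = 0`, inertia trivial) and `det(1 - TΦ) = ∏ (1 - xᵢ T)` on `rec(π_v)`; this
transfers to the equivalent `rℂ^{F-ss}` and then to `rℂ` (same `N`, same inertia, Frobenius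
differing by a commuting nilpotent).  (Jacquet–Langlands 1970, Prop. 3.5; Harris–Taylor 2001,
Thm. A (ii), (v); Tate 1979, (4.1.6); Deligne 1973, §8.6.) [cite: JacquetLanglands1970, Prop. 3.5]
[cite: HarrisTaylorAMS2001, Thm. A (ii), (v)] [cite: TateCorvallis1979, (4.1.6)] -/
theorem WeilDeligneRep.unramified_of_hasFrobSemisimpleClass_recGL_of_isSatakeParameter
    (d : LocalLanglandsDatum F) (πv : SmoothIrrep (GL (Fin 2) F))
    {ψ : AddChar F Circle} (hψ : ψ.IsContinuousNontrivial) (hgen : IsGeneric πv.ρ ψ)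
    {ϖ : Fˣ} (hϖ : IsUniformizingElement (ϖ : F)) {x : Fin 2 → ℂ}
    (hα : IsSatakeParameter πv.ρ ϖ ((univ : Finset (Fin 2)).val.map x))
    {rℂ : WeilDeligneRep F ℂ (Fin 2 → ℂ)}
    (hcl : rℂ.HasFrobSemisimpleClass (d.recGL 2 (IrrClass.mk πv))) :
    esymm x 2 ≠ 0 ∧ rℂ.N = 0 ∧ WeilGroup.IsUnramifiedRep rℂ.ρ ∧
      (LinearMap.toMatrix' (rℂ.ρ (WeilDeligneRep.geomFrob F d.hex))).charpolyRev =
        1 - C (esymm x 1) * X + C (esymm x 2) * X ^ 2 := by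
  classical
  haveI := πv.isIrreducible
  have hπ : πv.ρ.IsSmooth := πv.isSmooth
  letI : MeasurableSpace F := borel F
  haveI : BorelSpace F := ⟨rfl⟩
  letI : MeasurableSpace (GL (Fin 1) F ⧸ upperUnitriangular (Fin 1) F) := borel _
  haveI : BorelSpace (GL (Fin 1) F ⧸ upperUnitriangular (Fin 1) F) := ⟨rfl⟩
  obtain ⟨_, _, ν, hinv, hfin, hpos, -⟩ := exists_haar_measure_quotient_fin_one (F := F)
  haveI := hinv
  haveI := hfin
  haveI := hpos
  -- the trivial irreducible smooth representation of `GL₁(F)` on `ℂ`, generic for `ψ⁻¹`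
  let π' : SmoothIrrep (GL (Fin 1) F) :=
    { V := ℂ
      ρ := Representation.trivial ℂ (GL (Fin 1) F) ℂ
      isIrreducible := isIrreducible_of_finrank_eq_one' _ (Module.finrank_self ℂ)
      isSmooth := fun v => by
        have h : ((Representation.trivial ℂ (GL (Fin 1) F) ℂ).stabilizerSubgroup v :
            Set (GL (Fin 1) F)) = Set.univ := by
          ext g
          simp
        rw [Representation.IsSmoothVector, h]
        exact isOpen_univ }
  have hgen' : IsGeneric π'.ρ ψ⁻¹ := by
    refine (isGeneric_iff _ _).2 ⟨LinearMap.id, (mem_whittakerFunctionals_iff _).2 fun u v => ?_,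
      fun h => one_ne_zero (LinearMap.congr_fun h (1 : ℂ))⟩
    rw [upperUnitriangular_fin_one_coe_eq_one u, map_one, whittakerCharFun_fin_one, one_mul]
    rfl
  -- (iii-L): the JPSS `L`-polynomial of `(π_v, 1)` is the Euler factor `P₀` of `A₀ ⊗ B₀`
  set A₀ := (d.recGL 2 (IrrClass.mk πv)).out.1 with hA₀
  set B₀ := (d.recGL 1 (IrrClass.mk π')).out.1 with hB₀
  set P₀ : ℂ[X] := (A₀.tprod B₀).eulerFactor d.hn d.hex with hP₀
  have hRS₀ : HasRSLFactor Nat.one_lt_two πv.ρ π'.ρ ψ ν P₀ :=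
    (d.isLocalLanglands.lFactor_pairs Nat.one_pos Nat.one_lt_two πv π' ψ hψ hgen hgen' ν P₀).mpr hP₀
  -- `B₀ ≅ (1 ∘ artin, 0)`: `N = 0` and `ρ = 1`
  have hgl : B₀.IsEquivalent (WeilDeligneRep.ofQuasiChar d.hns d.artin 1) :=
    d.isLocalLanglands.gl_one 1 π' fun g v => by simp [π']
  obtain ⟨e⟩ := hgl
  set φ : (Fin 1 → ℂ) ≃ₗ[ℂ] ℂ := e.toRepEquiv.toLinearEquiv with hφ
  have hφρ : ∀ (u : WeilGroup F) (y : Fin 1 → ℂ),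
      φ (B₀.ρ u y) = (WeilDeligneRep.ofQuasiChar d.hns d.artin 1).ρ u (φ y) := fun u y => by
    rw [hφ, Representation.Equiv.toLinearEquiv_apply, Representation.Equiv.toLinearEquiv_apply]
    exact Representation.IntertwiningMap.isIntertwining _ _ e.toRepEquiv.toIntertwiningMap u y
  have hφN : ∀ y : Fin 1 → ℂ, φ (B₀.N y) = (WeilDeligneRep.ofQuasiChar d.hns d.artin 1).N (φ y) :=
    fun y => LinearMap.congr_fun e.comm_N y
  have hBρ : ∀ (u : WeilGroup F) (y : Fin 1 → ℂ), B₀.ρ u y = y := by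
    intro u y
    apply φ.injective
    rw [hφρ, WeilDeligneRep.ofQuasiChar_ρ_apply]
    simp
  have hBN : B₀.N = 0 := by
    refine LinearMap.ext fun y => φ.injective ?_
    rw [hφN, WeilDeligneRep.ofQuasiChar_N, LinearMap.zero_apply, LinearMap.zero_apply, map_zero]
  -- `P₀ = 1 - e₁ X + e₂ X²` by the spherical zeta integral
  have hfr : Module.finrank ℂ ((Fin 2 → ℂ) ⊗[ℂ] (Fin 1 → ℂ)) = 2 := by
    rw [Module.finrank_tensorProduct, Module.finrank_fin_fun, Module.finrank_fin_fun]
  have hdeg : P₀.natDegree ≤ 2 :=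
    (natDegree_eulerFactor_le _ d.hn d.hex).trans ((Submodule.finrank_le _).trans hfr.le)
  have hPx : P₀ = 1 - C (esymm x 1) * X + C (esymm x 2) * X ^ 2 := by
    rw [prod_one_sub_C_mul_X_eq_of_hasRSLFactor_of_natDegree_le_two πv.ρ hπ hψ hgen hϖ hα ν hRS₀ hdeg,
      prod_one_sub_C_mul_X_fin_two]
  -- `e₂ ≠ 0`, so `deg P₀ = 2 = dim`, hence `(ker N)^I = A₀ ⊗ B₀`
  obtain ⟨-, v₀, hv₀, hv₀0, hTv⟩ := hα
  have hmk : Units.mk0 (ϖ : F) hϖ.ne_zero = ϖ := Units.mk0_val _ _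
  have hT : ∀ r, 1 ≤ r → r ≤ 2 → heckeT πv.ρ (Units.mk0 (ϖ : F) hϖ.ne_zero) r v₀ =
      ((((Real.sqrt (residueFieldCard F)) ^ (r * (2 - r)) : ℝ) : ℂ) * esymm x r) • v₀ := by
    intro r _ hr2
    rw [hmk, hTv r hr2, ← esymm_eq_multiset_esymm]
  have he2 : esymm x 2 ≠ 0 := esymm_two_ne_zero_of_eigen πv.ρ hϖ hv₀ hv₀0 hT
  have hdeg2 : P₀.natDegree = 2 := by
    rw [hPx]
    have : (1 - C (esymm x 1) * X + C (esymm x 2) * X ^ 2 : ℂ[X]) =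
        C (esymm x 2) * X ^ 2 + C (-(esymm x 1)) * X + C 1 := by
      simp only [map_neg, map_one]; ring
    rw [this]
    exact Polynomial.natDegree_quadratic he2
  have htop : (A₀.tprod B₀).inertiaInvariantsKerN = ⊤ := by
    refine inertiaInvariantsKerN_eq_top_of_natDegree_eulerFactor_eq _ d.hn d.hex ?_
    rw [← hP₀, hdeg2, hfr]
  obtain ⟨hAN, hAρ⟩ := N_eq_zero_and_inertia_trivial_of_tprod_eq_top A₀ B₀ hBN hBρ htop
  -- the Euler factor is the reversed characteristic polynomial of `A₀.ρ Φ`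
  have hA : (A₀.ρ (WeilDeligneRep.geomFrob F d.hex)).charpoly.reverse =
      1 - C (esymm x 1) * X + C (esymm x 2) * X ^ 2 := by
    rw [← charpoly_tprod_ρ_eq A₀ B₀ hBρ (WeilDeligneRep.geomFrob F d.hex),
      ← eulerFactor_eq_reverse_charpoly_of_eq_top _ d.hn d.hex htop, ← hP₀, hPx]
  -- `rℂ^{F-ss} = r'' ≅ A₀`
  obtain ⟨r'', hss, hc⟩ := hcl
  have hrA : r''.IsEquivalent A₀ := Quotient.exact (hc.trans (Quotient.out_eq _).symm)
  obtain ⟨e'⟩ := hrA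
  set φ' : (Fin 2 → ℂ) ≃ₗ[ℂ] (Fin 2 → ℂ) := e'.toRepEquiv.toLinearEquiv with hφ'
  have hφ'ρ : ∀ (u : WeilGroup F) (y : Fin 2 → ℂ), φ' (r''.ρ u y) = A₀.ρ u (φ' y) := fun u y => by
    rw [hφ', Representation.Equiv.toLinearEquiv_apply, Representation.Equiv.toLinearEquiv_apply]
    exact Representation.IntertwiningMap.isIntertwining _ _ e'.toRepEquiv.toIntertwiningMap u y
  have hφ'N : ∀ y : Fin 2 → ℂ, φ' (r''.N y) = A₀.N (φ' y) := fun y => LinearMap.congr_fun e'.comm_N y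
  have hN'' : r''.N = 0 := by
    refine LinearMap.ext fun y => φ'.injective ?_
    rw [hφ'N, hAN, LinearMap.zero_apply, LinearMap.zero_apply, map_zero]
  have hρ'' : WeilGroup.IsUnramifiedRep r''.ρ := by
    intro u hu
    refine LinearMap.ext fun y => φ'.injective ?_
    rw [hφ'ρ, hAρ u hu]
    rfl
  have hch'' : (r''.ρ (WeilDeligneRep.geomFrob F d.hex)).charpoly =
      (A₀.ρ (WeilDeligneRep.geomFrob F d.hex)).charpoly := by
    have hconj : φ'.conj (r''.ρ (WeilDeligneRep.geomFrob F d.hex)) =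
        A₀.ρ (WeilDeligneRep.geomFrob F d.hex) := by
      refine LinearMap.ext fun y => ?_
      simp only [LinearEquiv.conj_apply, LinearMap.comp_apply, LinearEquiv.coe_coe, hφ'ρ,
        LinearEquiv.apply_symm_apply]
    rw [← hconj, LinearEquiv.charpoly_conj]
  -- … and `rℂ` has the same `N`, the same inertia action, and Frobenius differing by a nilpotent
  have hNss := hss.1
  have hIss := hss.2.1
  have hwss := hss.2.2
  refine ⟨he2, hNss ▸ hN'', fun u hu => (hIss u hu) ▸ hρ'' u hu, ?_⟩
  obtain ⟨-, n, hn, hcomm, hsum⟩ := hwss (WeilDeligneRep.geomFrob F d.hex)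
  have hchℂ : (rℂ.ρ (WeilDeligneRep.geomFrob F d.hex)).charpoly =
      (r''.ρ (WeilDeligneRep.geomFrob F d.hex)).charpoly := by
    rw [hsum]
    exact LinearMap.charpoly_add_eq_of_isNilpotent_of_commute hn hcomm
  rw [← Matrix.reverse_charpoly, ← charpoly_eq_charpoly_toMatrix', hchℂ, hch'', hA]

end Local

/-! ### Part 4: back to the global representation — inertia and the Frobenius bridge -/

section Matrices

/-- `charpolyRev` commutes with a change of scalars. [folklore] -/
theorem Matrix.charpolyRev_map {R S : Type*} [CommRing R] [CommRing S] {n : Type*} [Fintype n]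
    [DecidableEq n] (M : Matrix n n R) (f : R →+* S) :
    (M.map f).charpolyRev = M.charpolyRev.map f := by
  rw [Matrix.charpolyRev, Matrix.charpolyRev, ← Polynomial.coe_mapRingHom, RingHom.map_det,
    RingHom.mapMatrix_apply]
  congr 1
  ext i j
  by_cases hij : i = j
  · subst hij
    simp
  · simp [hij]

/-- The polynomial identity `e₂⁻¹ (1 - e₁ X + e₂ X²) = (X - x₀⁻¹)(X - x₁⁻¹)` for `e₁ = x₀ + x₁`,
`e₂ = x₀ x₁ ≠ 0`. [folklore] -/
theorem Polynomial.C_inv_mul_quadratic_eq {L : Type*} [Field L] {x₀ x₁ : L} (h0 : x₀ ≠ 0) (h1 : x₁ ≠ 0) :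
    C (x₀ * x₁)⁻¹ * (1 - C (x₀ + x₁) * X + C (x₀ * x₁) * X ^ 2) = (X - C x₀⁻¹) * (X - C x₁⁻¹) := by
  have e0 : C x₀⁻¹ * C x₀ = (1 : L[X]) := by rw [← C_mul, inv_mul_cancel₀ h0, C_1]
  have e1 : C x₁⁻¹ * C x₁ = (1 : L[X]) := by rw [← C_mul, inv_mul_cancel₀ h1, C_1]
  rw [mul_inv, C_mul, map_add, C_mul]
  linear_combination (X ^ 2 * (C x₁⁻¹ * C x₁) - C x₁⁻¹ * X) * e0 + (X ^ 2 - C x₀⁻¹ * X) * e1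

end Matrices

section Global

variable {K : Type} [Field K] [NumberField K] {ℓ : ℕ} [Fact ℓ.Prime]

/-- `arithFrobPolyOfSatake ι q 1 {x₀, x₁}` after `ι`: `(X - x₀⁻¹)(X - x₁⁻¹)`. [folklore] -/
theorem map_arithFrobPolyOfSatake_one_fin_two (ι : PadicAlgCl ℓ ≃+* ℂ) (q : ℕ) (x : Fin 2 → ℂ) :
    (arithFrobPolyOfSatake ι q 1 ((univ : Finset (Fin 2)).val.map x)).map (ι : PadicAlgCl ℓ →+* ℂ) =
      (X - C (x 0)⁻¹) * (X - C (x 1)⁻¹) := by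
  rw [arithFrobPolyOfSatake, Multiset.map_map, Finset.prod_map_val, Fin.prod_univ_two, Polynomial.map_mul]
  have h : ∀ a : ℂ, (X - C (ι.symm ((((Real.sqrt q : ℝ) : ℂ) ^ (1 - 1) * a)⁻¹))).map
      (ι : PadicAlgCl ℓ →+* ℂ) = X - C a⁻¹ := by
    intro a
    rw [Nat.sub_self, pow_zero, one_mul, Polynomial.map_sub, Polynomial.map_X, Polynomial.map_C,
      RingHom.coe_coe, RingEquiv.apply_symm_apply]
  simp only [Function.comp_apply]
  rw [h, h]

/-- **From the Weil–Deligne data at `w` back to `r`.**  Let `r : Γ_K → GL₂(E)` (`E = ℚ̄_ℓ`), `w` a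
finite place, `rv` attached to `r|_{W_{K_w}}` by the Grothendieck–Deligne recipe
(`IsWeilDeligneOfLadic`) and `rℂ` its transport along `ι : E ≃ ℂ`.  If `rℂ.N = 0`, `rℂ.ρ` is
unramified and `det(1 - T rℂ.ρ(Φ)) = 1 - e₁(x) T + e₂(x) T²` for the geometric Frobenius `Φ`
(`e₂(x) ≠ 0`), then `r` is unramified at `w` and every arithmetic Frobenius at `w` has
characteristic polynomial `∏ᵢ (X - ι⁻¹(xᵢ⁻¹)) = arithFrobPolyOfSatake ι q_w 1 {x₀, x₁}`:
the recipe with `N = 0` returns `r|_{W_{K_w}}` itself (Tate 1979, (4.2.1)), the transport is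
entrywise `ι`, `I_{𝔓₀} = res(I_{K_w})` and `res(Φ⁻¹)` is an arithmetic Frobenius at the prime
`𝔓₀ ∣ w` of the chosen embedding (Neukirch, Ch. II (9.6)), and
`charpoly(M⁻¹) = det(M)⁻¹ · det(1 - T M)` (Mathlib `Matrix.charpoly_inv`); finally Frobenii at
`w` are conjugate modulo inertia (`IsUnramifiedAt.hasFrobCharpolyAt_charpoly`, Serre, Ch. I §2.1).
[cite: TateCorvallis1979, (4.2.1)] [cite: NeukirchANT1999, Ch. II §9 Prop. (9.6)]
[cite: SerreAbelianLadic1968, Ch. I §2.1] -/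
theorem FramedGaloisRep.isUnramifiedAt_and_hasFrobCharpolyAt_of_weilDeligne (ι : PadicAlgCl ℓ ≃+* ℂ)
    (r : FramedGaloisRep K (PadicAlgCl ℓ) 2) (w : HeightOneSpectrum (𝓞 K))
    {rv : WeilDeligneRep (w.adicCompletion K) (PadicAlgCl ℓ) (Fin 2 → PadicAlgCl ℓ)}
    {rℂ : WeilDeligneRep (w.adicCompletion K) ℂ (Fin 2 → ℂ)}
    (hWD : IsWeilDeligneOfLadic (r.toLocal w).toWeilGroupHom rv)
    (hT : rv.IsTransportAlong (ι : PadicAlgCl ℓ →+* ℂ) rℂ)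
    (hex : exists_isFrobPow (F := w.adicCompletion K))
    (hN : rℂ.N = 0) (hur : WeilGroup.IsUnramifiedRep rℂ.ρ) {x : Fin 2 → ℂ} (he2 : esymm x 2 ≠ 0)
    (hch : (LinearMap.toMatrix' (rℂ.ρ (WeilDeligneRep.geomFrob _ hex))).charpolyRev =
        1 - C (esymm x 1) * X + C (esymm x 2) * X ^ 2) :
    r.IsUnramifiedAt w ∧
      r.HasFrobCharpolyAt w (arithFrobPolyOfSatake ι w.residueCard 1 ((univ : Finset (Fin 2)).val.map x)) := by
  classical
  set ιh : PadicAlgCl ℓ →+* ℂ := (ι : PadicAlgCl ℓ →+* ℂ) with hιh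
  have hιinj : Function.Injective ιh := ιh.injective
  set ρW := (r.toLocal w).toWeilGroupHom with hρW
  -- (a) `rv.N = 0` and `rv.ρ` is unramified (transport along the injective `ι`)
  have hNv : rv.N = 0 := by
    have h := hT.2
    rw [hN, map_zero] at h
    have h' : (LinearMap.toMatrix' rv.N).map ιh = (0 : Matrix (Fin 2) (Fin 2) (PadicAlgCl ℓ)).map ιh := by
      rw [← h, Matrix.map_zero _ (map_zero ιh)]
    exact (LinearEquiv.map_eq_zero_iff LinearMap.toMatrix').mp (Matrix.map_injective hιinj h')
  have hurv : WeilGroup.IsUnramifiedRep rv.ρ := by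
    intro u hu
    have h := hT.1 u
    rw [hur u hu, LinearMap.toMatrix'_one] at h
    have h' : (LinearMap.toMatrix' (rv.ρ u)).map ιh = (1 : Matrix (Fin 2) (Fin 2) (PadicAlgCl ℓ)).map ιh := by
      rw [← h, Matrix.map_one _ (map_zero ιh) (map_one ιh)]
    have h'' := Matrix.map_injective hιinj h'
    rw [← LinearMap.toMatrix'_one] at h''
    exact LinearMap.toMatrix'.injective h''
  -- (b) the recipe with `N = 0` returns `ρW` itself
  have hρWeq : ∀ u : WeilGroup (w.adicCompletion K), LinearMap.toMatrix' (rv.ρ u) =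
      ((ρW u : GL (Fin 2) (PadicAlgCl ℓ)) : Matrix (Fin 2) (Fin 2) (PadicAlgCl ℓ)) := by
    obtain ⟨t, U, Φ₁, -, -, hΦ₁, -, -, h3⟩ := hWD
    intro u
    have hmem : Φ₁ ^ (WeilGroup.deg u) * u ∈ WeilGroup.inertia (w.adicCompletion K) := WeilGroup.zpow_deg_mul_mem_inertia hΦ₁ u
    have key := h3 (-WeilGroup.deg u) ⟨Φ₁ ^ (WeilGroup.deg u) * u, hmem⟩
    have hu : Φ₁ ^ (-WeilGroup.deg u) * (Φ₁ ^ (WeilGroup.deg u) * u) = u := by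
      rw [← mul_assoc, zpow_neg, inv_mul_cancel, one_mul]
    simp only [hu, hNv, map_zero, smul_zero, neg_zero, IsNilpotent.exp_zero, mul_one] at key
    exact key
  -- (c) `ρW`, hence `r|_{Γ_{K_w}}`, is trivial on inertia: `r` is unramified at `w`
  have hρWI : ∀ u ∈ WeilGroup.inertia (w.adicCompletion K), ρW u = 1 := by
    intro u hu
    refine Units.ext ?_
    rw [← hρWeq u, hurv u hu, LinearMap.toMatrix'_one, Units.val_one]
  have hloc : ∀ σ ∈ absInertia (w.adicCompletion K), r.toLocal w σ = 1 := by
    intro σ hσ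
    set u : WeilGroup (w.adicCompletion K) := ⟨σ, absInertia_le_weilSubgroup (w.adicCompletion K) hσ⟩ with hu_def
    have hu : u ∈ WeilGroup.inertia (w.adicCompletion K) := by
      rw [WeilGroup.mem_inertia_iff]; exact hσ
    have h := hρWI u hu
    rwa [hρW, FramedRep.toWeilGroupHom_apply] at h
  have hunr' : r.toGaloisRep.IsUnramifiedAt w := by
    refine (GaloisRep.isUnramifiedAt_iff_toLocal_holds w r.toGaloisRep).mpr fun σ hσ => ?_
    have h3 : FramedRep.toRepresentation r (absGaloisRestrict K (w.adicCompletion K) σ) = 1 := by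
      rw [FramedRep.toRepresentation_apply_eq_one_iff]
      exact hloc σ hσ
    exact h3
  have hunr : r.IsUnramifiedAt w := (r.isUnramifiedAt_toGaloisRep_iff w).mp hunr'
  refine ⟨hunr, ?_⟩
  -- (d) the arithmetic Frobenius `res(Φ⁻¹)` at `𝔓₀`
  set Φ : WeilGroup (w.adicCompletion K) := WeilDeligneRep.geomFrob (w.adicCompletion K) hex with hΦ_def
  set τ : absoluteGaloisGroup (w.adicCompletion K) := WeilGroup.toAbsGalois (w.adicCompletion K) Φ with hτ
  have hτ' : IsFrobPow τ (-1) := by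
    rw [hτ, hΦ_def, WeilDeligneRep.geomFrob, WeilGroup.toAbsGalois_mk]
    exact Classical.choose_spec (hex (-1))
  have hτinv : IsAbsArithFrob τ⁻¹ := by
    have h := hτ'.inv
    rw [neg_neg] at h
    exact isFrobPow_one_iff_isAbsArithFrob_holds.mp h
  have hq : residueFieldCard (w.adicCompletion K) = Nat.card (𝓞 K ⧸ w.asIdeal) := by
    rw [residueFieldCard_adicCompletion_eq K w, HeightOneSpectrum.residueCard_eq_card_quotient]
  set σ : absoluteGaloisGroup K := absGaloisRestrict K (w.adicCompletion K) τ⁻¹ with hσ_def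
  have hσ : IsArithFrobAt (𝓞 K) σ (adicCompletionPrime K w) :=
    (isArithFrobAt_absGaloisRestrict_adicCompletionPrime_iff K w hq τ⁻¹).mpr hτinv
  -- (e) the matrices
  set ME : Matrix (Fin 2) (Fin 2) (PadicAlgCl ℓ) :=
    ((ρW Φ : GL (Fin 2) (PadicAlgCl ℓ)) : Matrix (Fin 2) (Fin 2) (PadicAlgCl ℓ)) with hME
  have hM : LinearMap.toMatrix' (rℂ.ρ Φ) = ME.map ιh := by rw [hT.1 Φ, hρWeq Φ]
  have hrσ : ((r σ : GL (Fin 2) (PadicAlgCl ℓ)) : Matrix (Fin 2) (Fin 2) (PadicAlgCl ℓ)) = ME⁻¹ := by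
    have h1 : r σ = (ρW Φ)⁻¹ := by
      rw [hσ_def, ← FramedGaloisRep.toLocal_apply, map_inv, hρW, FramedRep.toWeilGroupHom_apply]
    rw [h1, Matrix.coe_units_inv]
  -- `charpoly (ME⁻¹) = det(ME)⁻¹ · charpolyRev ME`, and after `ι`: `e₂⁻¹ (1 - e₁ X + e₂ X²)`
  have hMEu : IsUnit ME := Units.isUnit _
  have hchE : ME⁻¹.charpoly = C (ME.det)⁻¹ * ME.charpolyRev := by
    rw [Matrix.charpoly_inv ME hMEu, Fintype.card_fin, Ring.inverse_eq_inv']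
    norm_num
  have hdetM : (ME.map ιh).det = esymm x 2 := by
    -- `det M = charpoly(M).coeff 0 = charpolyRev(M).coeff 2`
    have h1 : (ME.map ιh).det = (ME.map ιh).charpolyRev.coeff 2 := by
      rw [← Matrix.reverse_charpoly, Polynomial.coeff_reverse, Matrix.charpoly_natDegree_eq_dim,
        Fintype.card_fin, Polynomial.revAt_le le_rfl, Nat.sub_self, Matrix.det_eq_sign_charpoly_coeff,
        Fintype.card_fin]
      norm_num
    rw [h1, ← hM, hch]
    simp [Polynomial.coeff_one]
  have hx0 : x 0 ≠ 0 := by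
    intro h; apply he2; rw [esymm_fin_two_two, h, zero_mul]
  have hx1 : x 1 ≠ 0 := by
    intro h; apply he2; rw [esymm_fin_two_two, h, mul_zero]
  have hmapE : (ME⁻¹.charpoly).map ιh =
      (arithFrobPolyOfSatake ι w.residueCard 1 ((univ : Finset (Fin 2)).val.map x)).map ιh := by
    rw [hιh, map_arithFrobPolyOfSatake_one_fin_two, ← hιh, hchE, Polynomial.map_mul, Polynomial.map_C,
      map_inv₀, RingHom.map_det, RingHom.mapMatrix_apply, ← Matrix.charpolyRev_map, hdetM, ← hM, hch,
      esymm_fin_two_one, esymm_fin_two_two]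
    exact Polynomial.C_inv_mul_quadratic_eq hx0 hx1
  have hcharE : FramedRep.charpoly r σ =
      arithFrobPolyOfSatake ι w.residueCard 1 ((univ : Finset (Fin 2)).val.map x) := by
    unfold FramedRep.charpoly
    rw [hrσ]
    exact Polynomial.map_injective ιh hιinj hmapE
  -- (f) all Frobenii at `w`
  have hP := hunr'.hasFrobCharpolyAt_charpoly (adicCompletionPrime_mem_primesAbove K w) hσ
  have hP' := (FramedGaloisRep.hasFrobCharpolyAt_toGaloisRep_iff w _ r).mp hP
  have hPeq : FramedRep.charpoly r σ = (r.toGaloisRep σ).charpoly :=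
    hP' _ (adicCompletionPrime_mem_primesAbove K w) σ hσ
  rw [← hcharE, hPeq]
  exact hP'

/-- **Clause (i) of Carayol's compatibility from local–global compatibility.**  `K` totally real,
`π` regular algebraic cuspidal on `GL₂(𝔸_K)`, `ℓ` prime, `ι : ℚ̄_ℓ ≃ ℂ`, `r : Γ_K → GL₂(ℚ̄_ℓ)`
irreducible and compatible with `π` (`C`-normalisation) at almost every finite place; then at
every finite `w ∤ ℓ`, `IsGaloisCompatibleAt π ι r w`: for every Satake parameter `α` of `π` at
`w`, `r` is unramified at `w` with `charpoly(r(Frob_w)) = ∏ (X - ι⁻¹((q^{1/2} αⱼ)⁻¹))`.  Proof: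
inverse half twist `π₁ = π ⊗ |det|^{-1/2}` (`L`-algebraic, regular, Satake parameter
`β = q^{1/2} α` at `w`); `galoisRep_GL2_totallyReal_localGlobal` at `w` gives the local component
`π₁,w`, the recipe `rv`, its transport `rℂ` and `rℂ^{F-ss} ∈ rec_w(π₁,w)`; `π₁,w` is generic
(`exists_isGeneric_of_hasLocalComponentAt`) and has the Satake parameter `β`
(`isSatakeParameter_of_hasLocalComponentAt`, Flath); the local deduction
(`WeilDeligneRep.unramified_of_hasFrobSemisimpleClass_recGL_of_isSatakeParameter`) and the
bridge back to `r` (`FramedGaloisRep.isUnramifiedAt_and_hasFrobCharpolyAt_of_weilDeligne`);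
finally `arithFrobPolyOfSatake ι q 1 β = arithFrobPolyOfSatake ι q 2 α`.
[cite: CarayolASENS1986, Thm. (A) (pp. 410–411)] [cite: Skinner2009, (1) p. 242] -/
theorem Carayol1986_unramifiedCompatibility.compatible_of_localGlobal
    (hLG : galoisRep_GL2_totallyReal_localGlobal)
    (hcpt : isCompact_glFiniteIntegralLevel 2 K)
    (hK : IsTotallyReal K) (π : CuspidalAutomorphicRepData 2 K hcpt) (hreg : π.1.IsRegularAlgebraic)
    (ι : PadicAlgCl ℓ ≃+* ℂ) (r : FramedGaloisRep K (PadicAlgCl ℓ) 2)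
    (hirr : r.toGaloisRep.IsIrreducible)
    (hae₀ : ∀ᶠ v : HeightOneSpectrum (𝓞 K) in cofinite,
      ∃ α : Multiset ℂ, π.1.HasSatakeParamAt v α ∧ r.IsUnramifiedAt v ∧
        r.HasFrobCharpolyAt v (arithFrobPolyOfSatake ι v.residueCard 2 α))
    (w : HeightOneSpectrum (𝓞 K)) (hw : ((ℓ : ℕ) : 𝓞 K) ∉ w.asIdeal) :
    IsGaloisCompatibleAt π.1 ι r w := by
  intro α hα
  obtain ⟨T, hT, hC, hTreg⟩ := hreg
  -- the inverse half twist `π₁ = π ⊗ |det|^{-1/2}`: `L`-algebraic with a regular infinity type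
  obtain ⟨χ, π₁, hχ, hW, hW', hT₁⟩ := π.exists_twist_hasInfinityType (-(((2 : ℝ) - 1) / 2)) hT
  have e : (((-(((2 : ℝ) - 1) / 2) : ℝ)) : ℂ) = -((((2 : ℕ) : ℂ) - 1) / 2) := by push_cast; ring
  have hL₁ : π₁.1.IsLAlgebraic :=
    ⟨_, hT₁, InfinityType.isLAlgebraic_twist_of_isCAlgebraic hC e⟩
  have hreg₁ : ∃ T' : InfinityType K 2, π₁.1.HasInfinityType T' ∧ T'.IsRegular :=
    ⟨_, hT₁, hTreg.twist _⟩
  have hae : SatakeFrobCompatibleAE ι π₁.1 r := by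
    filter_upwards [hae₀] with v ⟨β, hβ, hurv, hchv⟩
    refine ⟨_, AutomorphicRepData.HasSatakeParamAt.of_map_mulChar_detTwist_of_cpow hχ hW hW' hβ,
      hurv, ?_⟩
    rwa [arithFrobPolyOfSatake_one_map_cpow_half_two ι v.residueCard]
  have hβ := AutomorphicRepData.HasSatakeParamAt.of_map_mulChar_detTwist_of_cpow hχ hW hW' hα
  -- local–global compatibility for `π₁` at `w`
  obtain ⟨llc, hllc⟩ := hLG K hK
  obtain ⟨-, hall⟩ := hllc hcpt π₁ hL₁ hreg₁ ℓ ι r hirr hae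
  obtain ⟨πv, rv, rℂ, hloc, hWD, -, hTr, hcl⟩ := hall w
  haveI := πv.isIrreducible
  -- `π₁,w` is generic and has the Satake parameter `β`
  obtain ⟨ψ, hψ, hgen⟩ := π₁.exists_isGeneric_of_hasLocalComponentAt w πv.ρ πv.isSmooth hloc
  obtain ⟨ϖ, hϖ⟩ := Valuation.exists_isUniformizer_of_isCyclic_of_nontrivial (valuation (w.adicCompletion K))
  set ϖu : (w.adicCompletion K)ˣ := Units.mk0 (ϖ : w.adicCompletion K) hϖ.ne_zero with hϖu
  have hϖu' : IsUniformizingElement ((ϖu : (w.adicCompletion K)ˣ) : w.adicCompletion K) :=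
    isUniformizingElement_of_isUniformizer hϖ
  have hsat := π₁.isSatakeParameter_of_hasLocalComponentAt w πv.ρ πv.isSmooth hloc hβ (ϖ' := ϖu) hϖ
  obtain ⟨x, hx⟩ := exists_univ_val_map_eq (R := ℂ) hsat.1
  rw [← hx] at hsat
  -- the local deduction and the bridge back to `r`
  obtain ⟨he2, hN, hur, hch⟩ :=
    WeilDeligneRep.unramified_of_hasFrobSemisimpleClass_recGL_of_isSatakeParameter (llc w) πv hψ hgen
      hϖu' hsat hcl
  obtain ⟨hunr, hchar⟩ := FramedGaloisRep.isUnramifiedAt_and_hasFrobCharpolyAt_of_weilDeligne ι r w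
    (hWD hw) hTr (llc w).hex hN hur he2 hch
  refine ⟨hunr, ?_⟩
  rwa [hx, arithFrobPolyOfSatake_one_map_cpow_half_two ι w.residueCard] at hchar

/-- **Carayol's theorem (both clauses) from local–global compatibility**: the named fact
`Carayol1986_unramifiedCompatibility` (`HilbertModularGaloisRepUnramified`) follows from the named
fact `galoisRep_GL2_totallyReal_localGlobal` (`HilbertModularLocalGlobal`) — clause (i) by
`compatible_of_localGlobal`, clause (ii) by `unramified_of_localGlobal`
(`CarayolUnramifiedOfLocalGlobalProofs`). [cite: CarayolASENS1986, Thm. (A) (pp. 410–411)] -/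
theorem Carayol1986_unramifiedCompatibility_of_localGlobal (hLG : galoisRep_GL2_totallyReal_localGlobal) :
    Carayol1986_unramifiedCompatibility := by
  intro K _ _ hcpt hK π hreg ℓ _ ι r hirr hae w hw
  exact ⟨Carayol1986_unramifiedCompatibility.compatible_of_localGlobal hLG hcpt hK π hreg ι r hirr hae w hw,
    fun hur => Carayol1986_unramifiedCompatibility.unramified_of_localGlobal hLG hcpt hK π hreg ℓ ι r
      hirr hae w hw hur⟩

/-- **`Langlands1980_quadraticBaseChange_frobCompatible` from four named facts of the tree**, none of
them Carayol's theorem or `exists_galoisRep_of_regularAlgebraic`: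
`galoisRep_GL2_totallyReal_localGlobal`, `ArthurClozel1989_strongLifting_archimedean`,
`baseChange_cyclic_cuspidal`, `ArthurClozel1989_strongLifting_unramified`
(`…_of_facts` with `Carayol1986_unramifiedCompatibility_of_localGlobal`).
[cite: LanglandsBaseChange1980, §2 (A), (F)] [cite: CarayolASENS1986, Thm. (A)] -/
theorem Langlands1980_quadraticBaseChange_frobCompatible_of_localGlobal_of_baseChange
    (hLG : galoisRep_GL2_totallyReal_localGlobal)
    (hArch : ArthurClozel1989_strongLifting_archimedean)
    (hBCc : baseChange_cyclic_cuspidal) (hACu : ArthurClozel1989_strongLifting_unramified) :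
    Langlands1980_quadraticBaseChange_frobCompatible :=
  Langlands1980_quadraticBaseChange_frobCompatible_of_facts
    (Carayol1986_unramifiedCompatibility_of_localGlobal hLG) hArch hBCc hACu

end Global

end Literature.NumberTheory.Automorphic

end
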